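import Literature.NumberTheory.EllipticCurves.LatticeEndomorphism
import HarnessLib

/-!
# The transformation identity `℘(αz) = (P/Q)(℘(z))` from a certificate of complex multiplication

Topic `NumberTheory/EllipticCurves`; a proofs-only companion (theorems only, no definitions, no
named facts) of `LatticeEndomorphism.lean`, in `namespace PeriodPair` (deliberate dot-notation
extensions of Mathlib's `PeriodPair`, as there).  That file turns a pair of polynomials
`P, Q ∈ ℂ[X]` satisfying the transformation identities `(H1)`, `(H2)` of a lattice `Λ` with
multiplier `α ≠ 0` (the polynomial form of "`u = (P/Q)(℘)` solves `u'² = α² f(u)`,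
`u'' = α²(6u² − g₂/2)`", `f = 4X³ − g₂X − g₃`) into the inclusion `αΛ ⊆ Λ`
(`PeriodPair.mul_mem_lattice_of_transformation`); on the way it shows that
`P(℘ ζ) = ℘(c' + αζ)·Q(℘ ζ)` for some constant `c'`, which it does not export.  Here the constant is
exported and then eliminated:

* `PeriodPair.exists_const_eval_weierstrassP_eq` — Steps 0–3 of that proof, verbatim: there is
  `c' ∈ ℂ` with `P(℘ ζ) = ℘(c' + αζ) Q(℘ ζ)` whenever `ζ ∉ Λ`, `c' + αζ ∉ Λ`;
* `PeriodPair.const_mem_lattice_of_natDegree_lt` — if moreover `deg Q < deg P` then `c' ∈ Λ`: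
  otherwise `℘(c' + αζ) → ℘(c')` as `ζ → 0` while `‖(P/Q)(℘ ζ)‖ → ∞` (`℘ ζ → ∞` and
  `deg P > deg Q`).  (For the transformation polynomials of a complex multiplication,
  `deg P = N(α) = deg Q + 1`; a pair `(P, Q)` satisfying `(H1)`, `(H2)` with `deg P ≤ deg Q` would
  describe `℘(c' + αz)` for a half-period `c'`.)
* `PeriodPair.eval_weierstrassP_eq_weierstrassP_mul_mul` — **the transformation identity**
  `P(℘ z) = ℘(αz)·Q(℘ z)` for `z ∉ Λ`, `αz ∉ Λ`, i.e. `℘(αz) = (P/Q)(℘ z)` (Weber, *Lehrbuch der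
  Algebra* III §§ 114–115; Cox, *Primes of the form x² + ny²*, Thm. 10.14 and Prop. 14.9:
  "`℘(αz) = R(℘(z))` for a rational function `R`"; Silverman, *Advanced Topics*, II.2);
* `PeriodPair.mul_notMem_lattice_of_eval_ne_zero` — `Q(℘ z) ≠ 0` forces `αz ∉ Λ` (the poles of
  `℘(α·)` are zeros of `Q(℘)`);
* `PeriodPair.derivWeierstrassP_mul_of_transformation` — the derivative
  `α ℘'(αz) Q(℘ z)² = (P'Q − PQ')(℘ z)·℘'(z)`, i.e. `℘'(αz) = α⁻¹ R'(℘ z) ℘'(z)` (Cox, Prop. 14.9: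
  "`α(x, y) = (R(x), α⁻¹R'(x)y)`").

These serve the construction of the complex multiplications of the nine class-number-one CM
curves over `ℚ` as algebraic endomorphisms over `ℚ̄` (the degree condition and `(H1)`, `(H2)` are
what the kernel-checked certificates `CMCert.check` of `SingularModuliCertificate.lean` verify).
Also two elementary asymptotic lemmas on complex polynomials (`tendsto_eval_div_pow_cobounded`,
`tendsto_norm_eval_div_eval_atTop`), for which Mathlib (`Analysis/Polynomial/Basic.lean`) only has
ordered-field versions.

## References

* H. Weber, *Lehrbuch der Algebra*, Bd. III, 2. Aufl., Vieweg 1908, §§ 114–115.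
* D. A. Cox, *Primes of the form x² + ny²*, 2nd ed., Wiley 2013, Thm. 10.14, Prop. 14.9
  (PDF pp. 318–319).
* J. H. Silverman, *Advanced Topics in the Arithmetic of Elliptic Curves*, GTM 151 (1994), §II.2.
* E. T. Whittaker, G. N. Watson, *A Course of Modern Analysis*, 4th ed., CUP 1927, §20.22.
-/

noncomputable section

open Complex Filter Topology Bornology Set Polynomial

namespace PeriodPair

variable (L : PeriodPair)

/-! ### Two asymptotic lemmas on complex polynomials -/

/-- `S(x)/x^m → coeff_m(S)` as `x → ∞` in `ℂ`, for `m ≥ deg S` (so the limit is the leading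
coefficient if `m = deg S` and `0` if `m > deg S`). [folklore] -/
theorem _root_.Polynomial.tendsto_eval_div_pow_cobounded (S : ℂ[X]) {m : ℕ}
    (hm : S.natDegree ≤ m) :
    Tendsto (fun x : ℂ ↦ S.eval x / x ^ m) (cobounded ℂ) (𝓝 (S.coeff m)) := by
  have hsum : ∀ x : ℂ, x ≠ 0 → S.eval x / x ^ m =
      ∑ i ∈ Finset.range (m + 1), S.coeff i * (x⁻¹) ^ (m - i) := by
    intro x hx
    rw [eval_eq_sum_range' (Nat.lt_succ_of_le hm), Finset.sum_div]
    refine Finset.sum_congr rfl fun i hi ↦ ?_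
    have hi' : i ≤ m := Nat.lt_succ_iff.mp (Finset.mem_range.mp hi)
    rw [mul_div_assoc, inv_pow]
    congr 1
    rw [pow_sub₀ _ hx hi', mul_inv, inv_inv, div_eq_mul_inv, mul_comm]
  have hlim : Tendsto (fun x : ℂ ↦ ∑ i ∈ Finset.range (m + 1), S.coeff i * (x⁻¹) ^ (m - i))
      (cobounded ℂ) (𝓝 (∑ i ∈ Finset.range (m + 1), S.coeff i * (0 : ℂ) ^ (m - i))) := by
    refine tendsto_finsetSum _ fun i _ ↦ ?_
    exact (tendsto_inv₀_cobounded.pow (m - i)).const_mul _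
  have hval : ∑ i ∈ Finset.range (m + 1), S.coeff i * (0 : ℂ) ^ (m - i) = S.coeff m := by
    rw [Finset.sum_eq_single m]
    · simp
    · intro i hi him
      have : m - i ≠ 0 := Nat.sub_ne_zero_of_lt (lt_of_le_of_ne
        (Nat.lt_succ_iff.mp (Finset.mem_range.mp hi)) him)
      simp [zero_pow this]
    · intro h; exact absurd (Finset.self_mem_range_succ m) h
  rw [hval] at hlim
  refine hlim.congr' ?_
  filter_upwards [eventually_ne_cobounded (0 : ℂ)] with x hx using (hsum x hx).symm

/-- `‖P(x)/Q(x)‖ → ∞` as `x → ∞` in `ℂ` when `deg Q < deg P`. [folklore] -/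
theorem _root_.Polynomial.tendsto_norm_eval_div_eval_atTop {P Q : ℂ[X]} (hQ0 : Q ≠ 0)
    (hdeg : Q.natDegree < P.natDegree) :
    Tendsto (fun x : ℂ ↦ ‖P.eval x / Q.eval x‖) (cobounded ℂ) atTop := by
  have hP0 : P ≠ 0 := by rintro rfl; simp at hdeg
  set k := P.natDegree with hk
  have hlead : P.coeff k ≠ 0 := by
    rw [hk, coeff_natDegree]; exact leadingCoeff_ne_zero.mpr hP0
  have hQk : Q.coeff k = 0 := coeff_eq_zero_of_natDegree_lt hdeg
  have h1 : Tendsto (fun x : ℂ ↦ ‖P.eval x / x ^ k‖) (cobounded ℂ) (𝓝 ‖P.coeff k‖) :=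
    (P.tendsto_eval_div_pow_cobounded le_rfl).norm
  have h2 : Tendsto (fun x : ℂ ↦ ‖Q.eval x / x ^ k‖) (cobounded ℂ) (𝓝[>] 0) := by
    have h2a : Tendsto (fun x : ℂ ↦ ‖Q.eval x / x ^ k‖) (cobounded ℂ) (𝓝 0) := by
      have := (Q.tendsto_eval_div_pow_cobounded hdeg.le).norm
      rwa [hQk, norm_zero] at this
    refine tendsto_nhdsWithin_iff.mpr ⟨h2a, ?_⟩
    -- eventually `Q(x) ≠ 0` and `x ≠ 0`
    have hfin : {x : ℂ | Q.eval x = 0}.Finite :=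
      (Q.roots.toFinset.finite_toSet).subset fun x hx ↦ by
        simp only [Finset.mem_coe, Multiset.mem_toFinset]
        exact (mem_roots hQ0).mpr hx
    have hev : ∀ᶠ x : ℂ in cobounded ℂ, Q.eval x ≠ 0 := isBounded_def.mp hfin.isBounded
    filter_upwards [hev, eventually_ne_cobounded (0 : ℂ)] with x hx hx0
    exact norm_pos_iff.mpr (div_ne_zero hx (pow_ne_zero _ hx0))
  have h3 : Tendsto (fun x : ℂ ↦ ‖Q.eval x / x ^ k‖⁻¹) (cobounded ℂ) atTop :=
    h2.inv_tendsto_nhdsGT_zero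
  have h4 : Tendsto (fun x : ℂ ↦ ‖Q.eval x / x ^ k‖⁻¹ * ‖P.eval x / x ^ k‖) (cobounded ℂ) atTop :=
    h3.atTop_mul_pos (norm_pos_iff.mpr hlead) h1
  refine h4.congr' ?_
  filter_upwards [eventually_ne_cobounded (0 : ℂ)] with x hx
  have hxk : ‖x ^ k‖ ≠ 0 := norm_ne_zero_iff.mpr (pow_ne_zero _ hx)
  rw [norm_div, norm_div, norm_div]
  field_simp

/-! ### The constant of the transformation -/

/-- **Steps 0–3 of `PeriodPair.mul_mem_lattice_of_transformation`, with the constant exported.**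
If `α ≠ 0`, `Q ≠ 0` and `P, Q ∈ ℂ[X]` satisfy the transformation identities `(H1)`, `(H2)` of `Λ`
(see `LatticeEndomorphism.lean`), then for some `c' ∈ ℂ` one has
`P(℘ ζ) = ℘(c' + αζ)·Q(℘ ζ)` whenever `ζ ∉ Λ` and `c' + αζ ∉ Λ` (ODE uniqueness near a base
point, then analytic continuation over the connected co-countable set where both sides are
analytic).  The proof is that of the cited tree theorem, verbatim up to its Step 3. [folklore] -/
theorem exists_const_eval_weierstrassP_eq {α : ℂ} (hα : α ≠ 0) {P Q : ℂ[X]} (hQ0 : Q ≠ 0)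
    (h1 : (C 4 * X ^ 3 - C L.g₂ * X - C L.g₃) * (derivative P * Q - P * derivative Q) ^ 2 =
      C (α ^ 2) * ((C 4 * P ^ 3 - C L.g₂ * P * Q ^ 2 - C L.g₃ * Q ^ 3) * Q))
    (h2 : C 2 * ((((derivative (derivative P)) * Q - P * derivative (derivative Q)) * Q -
        C 2 * (derivative Q * (derivative P * Q - P * derivative Q))) *
        (C 4 * X ^ 3 - C L.g₂ * X - C L.g₃)) +
      (derivative P * Q - P * derivative Q) * Q * (C 12 * X ^ 2 - C L.g₂) =
      C (α ^ 2) * (C 12 * P ^ 2 * Q - C L.g₂ * Q ^ 3)) :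
    ∃ c' : ℂ, ∀ ζ : ℂ, ζ ∉ L.lattice → c' + α * ζ ∉ L.lattice →
      P.eval (℘[L] ζ) = ℘[L] (c' + α * ζ) * Q.eval (℘[L] ζ) := by
  have hopen : IsOpen ((L.lattice : Set ℂ)ᶜ) := L.isClosed_lattice.isOpen_compl
  -- Step 0: a base point `z₀ ∉ Λ` with `Q(℘(z₀)) ≠ 0`
  obtain ⟨x₀, hx₀⟩ : ∃ x₀ : ℂ, Q.eval x₀ ≠ 0 := by
    by_contra! H
    exact hQ0 (Polynomial.funext fun x ↦ by rw [H x, eval_zero])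
  obtain ⟨z₀, hz₀, hz₀x⟩ := L.exists_weierstrassP_eq x₀
  have hQz₀ : Q.eval (℘[L] z₀) ≠ 0 := by rwa [hz₀x]
  -- Step 1: initial data `(u(z₀), u'(z₀)/α) = (℘(c), ℘'(c))`
  set u : ℂ → ℂ := fun w ↦ P.eval (℘[L] w) / Q.eval (℘[L] w) with hu
  set u' : ℂ → ℂ := fun w ↦
    (derivative P * Q - P * derivative Q).eval (℘[L] w) * ℘'[L] w / Q.eval (℘[L] w) ^ 2 with hu'
  obtain ⟨c, hc, hcu, hcu'⟩ : ∃ c ∉ L.lattice, ℘[L] c = u z₀ ∧ ℘'[L] c = u' z₀ / α := by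
    obtain ⟨c₀, hc₀, hc₀u⟩ := L.exists_weierstrassP_eq (u z₀)
    have hsq : ℘'[L] c₀ ^ 2 = (u' z₀ / α) ^ 2 := by
      rw [L.derivWeierstrassP_sq c₀ hc₀, hc₀u, hu, hu',
        rationalMap_weierstrassP_deriv_sq hα h1 hz₀ hQz₀]
    rcases sq_eq_sq_iff_eq_or_eq_neg.mp hsq with h | h
    · exact ⟨c₀, hc₀, hc₀u, h⟩
    · refine ⟨-c₀, fun h' ↦ hc₀ (by simpa using neg_mem h'), ?_, ?_⟩
      · rw [L.weierstrassP_neg, hc₀u]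
      · rw [L.derivWeierstrassP_neg, h, neg_neg]
  -- Step 2: local agreement along real `t` by ODE uniqueness for `Y' = α (Y₂, 6Y₁² - g₂/2)`
  set Y₁ : ℝ → ℂ × ℂ := fun s ↦ (u (z₀ + s), u' (z₀ + s) / α) with hY₁
  set Y₂ : ℝ → ℂ × ℂ := fun s ↦ (℘[L] (c + α * s), ℘'[L] (c + α * s)) with hY₂
  have hY0 : Y₁ 0 = Y₂ 0 := by simp [hY₁, hY₂, hcu, hcu']
  obtain ⟨K, S, hS, hK⟩ := ((L.contDiff_weierstrassField.const_smul α).contDiffAt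
    (x := (℘[L] c, ℘'[L] c))).exists_lipschitzOnWith
  have hz_ev : ∀ᶠ s : ℝ in 𝓝 0, z₀ + (s : ℂ) ∉ L.lattice ∧ Q.eval (℘[L] (z₀ + s)) ≠ 0 := by
    have hc1 : Continuous fun s : ℝ ↦ z₀ + (s : ℂ) := by fun_prop
    have h1 : (fun s : ℝ ↦ z₀ + (s : ℂ)) ⁻¹' (L.lattice : Set ℂ)ᶜ ∈ 𝓝 (0 : ℝ) :=
      hc1.continuousAt.preimage_mem_nhds (hopen.mem_nhds (by simpa using hz₀))
    have hc2 : ContinuousAt (fun s : ℝ ↦ Q.eval (℘[L] (z₀ + (s : ℂ)))) 0 := by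
      have ha : ContinuousAt (fun s : ℝ ↦ z₀ + (s : ℂ)) 0 := hc1.continuousAt
      have hb : ContinuousAt ℘[L] ((fun s : ℝ ↦ z₀ + (s : ℂ)) 0) :=
        (L.analyticOnNhd_weierstrassP _ (by simpa using hz₀)).continuousAt
      have hc : ContinuousAt (fun s : ℝ ↦ ℘[L] (z₀ + (s : ℂ))) 0 :=
        ContinuousAt.comp (g := ℘[L]) (f := fun s : ℝ ↦ z₀ + (s : ℂ)) (x := 0) hb ha
      exact ContinuousAt.comp (g := fun x ↦ Q.eval x) (f := fun s : ℝ ↦ ℘[L] (z₀ + (s : ℂ)))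
        (x := 0) Q.continuous.continuousAt hc
    have h2 : ∀ᶠ s : ℝ in 𝓝 0, Q.eval (℘[L] (z₀ + (s : ℂ))) ≠ 0 :=
      hc2.eventually_ne (by simpa using hQz₀)
    filter_upwards [h1, h2] with s hs1 hs2 using ⟨hs1, hs2⟩
  have hc_ev : ∀ᶠ s : ℝ in 𝓝 0, c + α * (s : ℂ) ∉ L.lattice := by
    have hc1 : Continuous fun s : ℝ ↦ c + α * (s : ℂ) := by fun_prop
    have : (fun s : ℝ ↦ c + α * (s : ℂ)) ⁻¹' (L.lattice : Set ℂ)ᶜ ∈ 𝓝 (0 : ℝ) :=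
      hc1.continuousAt.preimage_mem_nhds (hopen.mem_nhds (by simpa using hc))
    filter_upwards [this] with s hs using hs
  have hY₁d : ∀ᶠ s : ℝ in 𝓝 0, HasDerivAt Y₁ (α • L.weierstrassField (Y₁ s)) s := by
    filter_upwards [hz_ev] with s hs
    have hd1 : HasDerivAt (fun r : ℝ ↦ u (z₀ + r)) (u' (z₀ + s)) s :=
      (HasDerivAt.comp_const_add z₀ (s : ℂ)
        (hasDerivAt_rationalMap_weierstrassP hs.1 hs.2)).comp_ofReal
    have hd2 : HasDerivAt (fun r : ℝ ↦ u' (z₀ + r) / α) (_ / α) s :=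
      (HasDerivAt.comp_const_add z₀ (s : ℂ)
        (hasDerivAt_rationalMap_weierstrassP_deriv hs.1 hs.2)).comp_ofReal.div_const α
    refine (hd1.prodMk hd2).congr_deriv ?_
    simp only [hY₁, hu, hu', weierstrassField, Prod.smul_mk, smul_eq_mul, Prod.mk.injEq]
    refine ⟨by field_simp, ?_⟩
    rw [rationalMap_weierstrassP_deriv_deriv_eq h2 hs.1 hs.2]
    field_simp
  have hY₂d : ∀ᶠ s : ℝ in 𝓝 0, HasDerivAt Y₂ (α • L.weierstrassField (Y₂ s)) s := by
    filter_upwards [hc_ev] with s hs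
    have e1 : HasDerivAt (fun r : ℂ ↦ c + α * r) α (s : ℂ) := by
      simpa using ((hasDerivAt_id (s : ℂ)).const_mul α).const_add c
    have hd1 : HasDerivAt (fun r : ℝ ↦ ℘[L] (c + α * r)) (℘'[L] (c + α * s) * α) s := by
      have h' : HasDerivAt (fun r : ℂ ↦ ℘[L] (c + α * r)) (℘'[L] (c + α * s) * α) s :=
        HasDerivAt.comp (h₂ := ℘[L]) (h := fun r : ℂ ↦ c + α * r) (s : ℂ)
          (hasDerivAt_weierstrassP hs) e1
      exact h'.comp_ofReal
    have hd2 : HasDerivAt (fun r : ℝ ↦ ℘'[L] (c + α * r))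
        ((6 * ℘[L] (c + α * s) ^ 2 - L.g₂ / 2) * α) s := by
      have h' : HasDerivAt (fun r : ℂ ↦ ℘'[L] (c + α * r))
          ((6 * ℘[L] (c + α * s) ^ 2 - L.g₂ / 2) * α) s :=
        HasDerivAt.comp (h₂ := ℘'[L]) (h := fun r : ℂ ↦ c + α * r) (s : ℂ)
          (L.hasDerivAt_derivWeierstrassP hs) e1
      exact h'.comp_ofReal
    refine (hd1.prodMk hd2).congr_deriv ?_
    simp only [hY₂, weierstrassField, Prod.smul_mk, smul_eq_mul, Prod.mk.injEq]
    exact ⟨by ring, by ring⟩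
  have hY₁S : ∀ᶠ s : ℝ in 𝓝 0, Y₁ s ∈ S := by
    have hcont : ContinuousAt Y₁ 0 := (hY₁d.self_of_nhds).continuousAt
    refine hcont.preimage_mem_nhds ?_
    have : Y₁ 0 = (℘[L] c, ℘'[L] c) := by simp [hY₁, hcu, hcu']
    rwa [this]
  have hY₂S : ∀ᶠ s : ℝ in 𝓝 0, Y₂ s ∈ S := by
    have hcont : ContinuousAt Y₂ 0 := (hY₂d.self_of_nhds).continuousAt
    refine hcont.preimage_mem_nhds ?_
    have : Y₂ 0 = (℘[L] c, ℘'[L] c) := by simp [hY₂]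
    rwa [this]
  have hloc : Y₁ =ᶠ[𝓝 0] Y₂ :=
    ODE_solution_unique_of_eventually (v := fun _ Y ↦ α • L.weierstrassField Y) (s := fun _ ↦ S)
      (Eventually.of_forall fun _ ↦ hK) (hY₁d.and hY₁S) (hY₂d.and hY₂S) hY0
  -- Step 3: `P(℘ ζ) = ℘(c' + α ζ) Q(℘ ζ)` on `V = {ζ ∉ Λ, c' + αζ ∉ Λ}`, `c' = c - α z₀`
  set c' : ℂ := c - α * z₀ with hc'
  set G : ℂ → ℂ := fun ζ ↦ P.eval (℘[L] ζ) - ℘[L] (c' + α * ζ) * Q.eval (℘[L] ζ) with hG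
  set V : Set ℂ := {ζ | ζ ∉ L.lattice ∧ c' + α * ζ ∉ L.lattice} with hV
  have hVeq : V = ((L.lattice : Set ℂ) ∪
      (fun m : ℂ ↦ (m - c') / α) '' (L.lattice : Set ℂ))ᶜ := by
    ext ζ
    simp only [hV, mem_setOf_eq, mem_compl_iff, mem_union, mem_image, SetLike.mem_coe, not_or,
      not_exists, not_and]
    constructor
    · rintro ⟨h1, h2⟩
      refine ⟨h1, fun m hm h ↦ h2 ?_⟩
      have e : c' + α * ((m - c') / α) = m := by field_simp; ring
      rw [← h, e]
      exact hm
    · rintro ⟨h1, h2⟩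
      refine ⟨h1, fun h ↦ h2 _ h ?_⟩
      field_simp
      ring
  have hVopen : IsOpen V :=
    (hopen.preimage continuous_id).inter (hopen.preimage (by fun_prop))
  have hVpre : IsPreconnected V := by
    rw [hVeq]
    exact (Set.Countable.isConnected_compl_of_one_lt_rank (by simp)
      (L.countable_lattice.union (L.countable_lattice.image _))).isPreconnected
  have hGan : AnalyticOnNhd ℂ G V := by
    refine DifferentiableOn.analyticOnNhd (fun ζ hζ ↦ ?_) hVopen
    have h℘1 : DifferentiableAt ℂ ℘[L] ζ :=
      L.differentiableOn_weierstrassP.differentiableAt (hopen.mem_nhds hζ.1)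
    have h℘2 : DifferentiableAt ℂ (fun ζ : ℂ ↦ ℘[L] (c' + α * ζ)) ζ := by
      have hi : DifferentiableAt ℂ (fun ζ : ℂ ↦ c' + α * ζ) ζ := by fun_prop
      exact (L.differentiableOn_weierstrassP.differentiableAt (hopen.mem_nhds hζ.2)).comp ζ hi
    have hP : DifferentiableAt ℂ (fun ζ ↦ P.eval (℘[L] ζ)) ζ := P.differentiableAt.comp ζ h℘1
    have hQ : DifferentiableAt ℂ (fun ζ ↦ Q.eval (℘[L] ζ)) ζ := Q.differentiableAt.comp ζ h℘1
    exact (hP.sub (h℘2.mul hQ)).differentiableWithinAt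
  have hz₀V : z₀ ∈ V := ⟨hz₀, by simpa [hc'] using hc⟩
  have hGfreq : ∃ᶠ ζ in 𝓝[≠] z₀, G ζ = (fun _ ↦ (0 : ℂ)) ζ := by
    have hreal : ∀ᶠ s : ℝ in 𝓝[≠] 0, G (z₀ + s) = 0 := by
      filter_upwards [mem_nhdsWithin_of_mem_nhds (hloc.and hz_ev)] with s hs
      have e1 : u (z₀ + s) = ℘[L] (c + α * s) := by
        simpa [hY₁, hY₂] using congrArg Prod.fst hs.1
      have e2 : c' + α * (z₀ + (s : ℂ)) = c + α * s := by rw [hc']; ring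
      simp only [hG, e2, ← e1, hu]
      field_simp [hs.2.2]
      ring
    have htend : Tendsto (fun s : ℝ ↦ z₀ + (s : ℂ)) (𝓝[≠] 0) (𝓝[≠] z₀) := by
      refine tendsto_nhdsWithin_of_tendsto_nhds_of_eventually_within _ ?_ ?_
      · have hc1 : Continuous fun s : ℝ ↦ z₀ + (s : ℂ) := by fun_prop
        have h := hc1.tendsto 0
        simp only [ofReal_zero, add_zero] at h
        exact h.mono_left nhdsWithin_le_nhds
      · filter_upwards [self_mem_nhdsWithin] with s (hs : s ≠ 0)
        simpa using hs
    exact htend.frequently hreal.frequently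
  have hGV : EqOn G (fun _ ↦ (0 : ℂ)) V :=
    hGan.eqOn_of_preconnected_of_frequently_eq analyticOnNhd_const hVpre hz₀V hGfreq
  refine ⟨c', fun ζ hζ hζ' ↦ ?_⟩
  have := hGV ⟨hζ, hζ'⟩
  simpa only [hG, sub_eq_zero] using this

/-- **The constant is a period when `deg Q < deg P`.**  If `P(℘ ζ) = ℘(c' + αζ) Q(℘ ζ)` whenever
`ζ ∉ Λ`, `c' + αζ ∉ Λ`, with `Q ≠ 0` and `deg Q < deg P`, then `c' ∈ Λ`: otherwise, as `ζ → 0`,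
`℘(c' + αζ) → ℘(c')` whereas `‖(P/Q)(℘ ζ)‖ → ∞` because `℘(ζ) → ∞`. [folklore] -/
theorem const_mem_lattice_of_natDegree_lt {α c' : ℂ} {P Q : ℂ[X]} (hQ0 : Q ≠ 0)
    (hdeg : Q.natDegree < P.natDegree)
    (h : ∀ ζ : ℂ, ζ ∉ L.lattice → c' + α * ζ ∉ L.lattice →
      P.eval (℘[L] ζ) = ℘[L] (c' + α * ζ) * Q.eval (℘[L] ζ)) :
    c' ∈ L.lattice := by
  by_contra hc'
  have hopen : IsOpen ((L.lattice : Set ℂ)ᶜ) := L.isClosed_lattice.isOpen_compl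
  -- the left-hand side stays bounded near `ζ = 0`
  have hcont : ContinuousAt (fun ζ : ℂ ↦ ℘[L] (c' + α * ζ)) 0 := by
    have h℘ : ContinuousAt ℘[L] ((fun ζ : ℂ ↦ c' + α * ζ) 0) :=
      (L.analyticOnNhd_weierstrassP _ (by simpa using hc')).continuousAt
    exact ContinuousAt.comp (g := ℘[L]) (f := fun ζ : ℂ ↦ c' + α * ζ) (x := 0) h℘ (by fun_prop)
  have hlhs : Tendsto (fun ζ : ℂ ↦ ‖℘[L] (c' + α * ζ)‖) (𝓝[≠] 0) (𝓝 ‖℘[L] (c' + α * 0)‖) :=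
    (hcont.tendsto.mono_left nhdsWithin_le_nhds).norm
  -- the right-hand side blows up
  have hrhs : Tendsto (fun ζ : ℂ ↦ ‖P.eval (℘[L] ζ) / Q.eval (℘[L] ζ)‖) (𝓝[≠] 0) atTop :=
    (tendsto_norm_eval_div_eval_atTop hQ0 hdeg).comp (L.tendsto_weierstrassP_cobounded (zero_mem _))
  -- and the two agree near `0`
  have e1 : ∀ᶠ ζ : ℂ in 𝓝[≠] 0, ζ ∉ L.lattice := L.eventually_nhdsNE_notMem_lattice
  have e2 : ∀ᶠ ζ : ℂ in 𝓝[≠] 0, c' + α * ζ ∉ L.lattice := by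
    have hc1 : Continuous fun ζ : ℂ ↦ c' + α * ζ := by fun_prop
    have : (fun ζ : ℂ ↦ c' + α * ζ) ⁻¹' (L.lattice : Set ℂ)ᶜ ∈ 𝓝 (0 : ℂ) :=
      hc1.continuousAt.preimage_mem_nhds (hopen.mem_nhds (by simpa using hc'))
    exact mem_nhdsWithin_of_mem_nhds this
  have e3 : ∀ᶠ ζ : ℂ in 𝓝[≠] 0, Q.eval (℘[L] ζ) ≠ 0 := by
    have hQev : ∀ᶠ x : ℂ in cobounded ℂ, Q.eval x ≠ 0 := by
      have hfin : {x : ℂ | Q.eval x = 0}.Finite :=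
        (Q.roots.toFinset.finite_toSet).subset fun x hx ↦ by
          simp only [Finset.mem_coe, Multiset.mem_toFinset]
          exact (mem_roots hQ0).mpr hx
      exact isBounded_def.mp hfin.isBounded
    exact (L.tendsto_weierstrassP_cobounded (zero_mem _)).eventually hQev
  have heq : (fun ζ : ℂ ↦ ‖℘[L] (c' + α * ζ)‖) =ᶠ[𝓝[≠] 0]
      fun ζ : ℂ ↦ ‖P.eval (℘[L] ζ) / Q.eval (℘[L] ζ)‖ := by
    filter_upwards [e1, e2, e3] with ζ h1 h2 h3
    rw [h ζ h1 h2, mul_div_cancel_right₀ _ h3]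
  exact (hlhs.congr' heq).not_tendsto (disjoint_nhds_atTop _) hrhs

/-! ### The transformation identity and its derivative -/

section Transformation

variable {L}
variable {α : ℂ} {P Q : ℂ[X]}

/-- **The transformation identity `℘(αz) = (P/Q)(℘ z)`.**  If `α ≠ 0`, `Q ≠ 0`, `deg Q < deg P` and
`P, Q` satisfy `(H1)`, `(H2)` for `Λ`, then `P(℘ z) = ℘(αz)·Q(℘ z)` for all `z ∉ Λ` with `αz ∉ Λ`
(Weber, *Algebra* III §§ 114–115; Cox, *Primes of the form x² + ny²*, Thm. 10.14 and Prop. 14.9: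
`℘(αz) = R(℘(z))`; here obtained from the certificate rather than from `αΛ ⊆ Λ`). [folklore] -/
theorem eval_weierstrassP_eq_weierstrassP_mul_mul (hα : α ≠ 0) (hQ0 : Q ≠ 0)
    (hdeg : Q.natDegree < P.natDegree)
    (h1 : (C 4 * X ^ 3 - C L.g₂ * X - C L.g₃) * (derivative P * Q - P * derivative Q) ^ 2 =
      C (α ^ 2) * ((C 4 * P ^ 3 - C L.g₂ * P * Q ^ 2 - C L.g₃ * Q ^ 3) * Q))
    (h2 : C 2 * ((((derivative (derivative P)) * Q - P * derivative (derivative Q)) * Q -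
        C 2 * (derivative Q * (derivative P * Q - P * derivative Q))) *
        (C 4 * X ^ 3 - C L.g₂ * X - C L.g₃)) +
      (derivative P * Q - P * derivative Q) * Q * (C 12 * X ^ 2 - C L.g₂) =
      C (α ^ 2) * (C 12 * P ^ 2 * Q - C L.g₂ * Q ^ 3))
    {z : ℂ} (hz : z ∉ L.lattice) (hαz : α * z ∉ L.lattice) :
    P.eval (℘[L] z) = ℘[L] (α * z) * Q.eval (℘[L] z) := by
  obtain ⟨c', hc'⟩ := L.exists_const_eval_weierstrassP_eq hα hQ0 h1 h2
  have hmem : c' ∈ L.lattice := L.const_mem_lattice_of_natDegree_lt hQ0 hdeg hc'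
  have hz' : c' + α * z ∉ L.lattice := fun h ↦ hαz (by simpa using sub_mem h hmem)
  have h := hc' z hz hz'
  rwa [add_comm, show ℘[L] (α * z + c') = ℘[L] (α * z) from
    L.weierstrassP_add_coe (α * z) ⟨c', hmem⟩] at h

/-- **The poles of `℘(α·)` are zeros of `Q(℘)`**: under the hypotheses of the transformation
identity, `Q(℘ z) ≠ 0` (`z ∉ Λ`) forces `αz ∉ Λ` — as `ζ → z` punctured, `αζ ∉ Λ` and
`℘(αζ) = (P/Q)(℘ ζ) → (P/Q)(℘ z)`, whereas `℘(αζ) → ∞` if `αz ∈ Λ`. [folklore] -/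
theorem mul_notMem_lattice_of_eval_ne_zero (hα : α ≠ 0) (hQ0 : Q ≠ 0)
    (hdeg : Q.natDegree < P.natDegree)
    (h1 : (C 4 * X ^ 3 - C L.g₂ * X - C L.g₃) * (derivative P * Q - P * derivative Q) ^ 2 =
      C (α ^ 2) * ((C 4 * P ^ 3 - C L.g₂ * P * Q ^ 2 - C L.g₃ * Q ^ 3) * Q))
    (h2 : C 2 * ((((derivative (derivative P)) * Q - P * derivative (derivative Q)) * Q -
        C 2 * (derivative Q * (derivative P * Q - P * derivative Q))) *
        (C 4 * X ^ 3 - C L.g₂ * X - C L.g₃)) +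
      (derivative P * Q - P * derivative Q) * Q * (C 12 * X ^ 2 - C L.g₂) =
      C (α ^ 2) * (C 12 * P ^ 2 * Q - C L.g₂ * Q ^ 3))
    {z : ℂ} (hz : z ∉ L.lattice) (hQz : Q.eval (℘[L] z) ≠ 0) : α * z ∉ L.lattice := by
  intro hαz
  have hopen : IsOpen ((L.lattice : Set ℂ)ᶜ) := L.isClosed_lattice.isOpen_compl
  -- punctured near `z`: `ζ ∉ Λ`, `αζ ∉ Λ`, `Q(℘ ζ) ≠ 0`
  have e1 : ∀ᶠ ζ : ℂ in 𝓝[≠] z, ζ ∉ L.lattice :=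
    mem_nhdsWithin_of_mem_nhds (hopen.mem_nhds hz)
  have htend : Tendsto (fun ζ : ℂ ↦ α * ζ) (𝓝[≠] z) (𝓝[≠] (α * z)) := by
    refine tendsto_nhdsWithin_of_tendsto_nhds_of_eventually_within _ ?_ ?_
    · exact ((continuous_const.mul continuous_id).tendsto z).mono_left nhdsWithin_le_nhds
    · filter_upwards [self_mem_nhdsWithin] with ζ (hζ : ζ ≠ z)
      exact fun h ↦ hζ (mul_left_cancel₀ hα h)
  have e2 : ∀ᶠ ζ : ℂ in 𝓝[≠] z, α * ζ ∉ L.lattice := by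
    have h' : ∀ᶠ w in 𝓝[≠] (α * z), w ∈ (L.lattice \ {α * z} : Set ℂ)ᶜ :=
      mem_nhdsWithin_of_mem_nhds (L.compl_lattice_sdiff_singleton_mem_nhds (α * z))
    have h'' : ∀ᶠ w in 𝓝[≠] (α * z), w ∉ L.lattice := by
      filter_upwards [h', self_mem_nhdsWithin] with w hw hwz
      simp only [Set.mem_compl_iff, Set.mem_sdiff, SetLike.mem_coe, Set.mem_singleton_iff, not_and,
        not_not] at hw
      exact fun hmem ↦ hwz (hw hmem)
    exact htend.eventually h''
  have e3 : ∀ᶠ ζ : ℂ in 𝓝[≠] z, Q.eval (℘[L] ζ) ≠ 0 := by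
    have hc : ContinuousAt (fun ζ ↦ Q.eval (℘[L] ζ)) z :=
      Q.continuous.continuousAt.comp (L.analyticOnNhd_weierstrassP z hz).continuousAt
    exact mem_nhdsWithin_of_mem_nhds (hc.eventually_ne hQz)
  -- `℘(αζ) = (P/Q)(℘ ζ)` there, with a finite limit …
  have hfin : Tendsto (fun ζ : ℂ ↦ P.eval (℘[L] ζ) / Q.eval (℘[L] ζ)) (𝓝[≠] z)
      (𝓝 (P.eval (℘[L] z) / Q.eval (℘[L] z))) := by
    have h℘ : ContinuousAt ℘[L] z := (L.analyticOnNhd_weierstrassP z hz).continuousAt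
    have hc : ContinuousAt (fun ζ ↦ P.eval (℘[L] ζ) / Q.eval (℘[L] ζ)) z :=
      (P.continuous.continuousAt.comp h℘).div (Q.continuous.continuousAt.comp h℘) hQz
    exact hc.tendsto.mono_left nhdsWithin_le_nhds
  -- … but `℘(αζ) → ∞`
  have hinf : Tendsto (fun ζ : ℂ ↦ ℘[L] (α * ζ)) (𝓝[≠] z) (cobounded ℂ) :=
    (L.tendsto_weierstrassP_cobounded hαz).comp htend
  have heq : (fun ζ : ℂ ↦ ℘[L] (α * ζ)) =ᶠ[𝓝[≠] z]
      fun ζ : ℂ ↦ P.eval (℘[L] ζ) / Q.eval (℘[L] ζ) := by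
    filter_upwards [e1, e2, e3] with ζ h1' h2' h3'
    rw [eval_weierstrassP_eq_weierstrassP_mul_mul hα hQ0 hdeg h1 h2 h1' h2', mul_div_cancel_right₀ _ h3']
  exact (hfin.congr' heq.symm).not_tendsto (Metric.disjoint_nhds_cobounded _) hinf

/-- **The derivative of the transformation identity**: under the same hypotheses,
`α ℘'(αz) Q(℘ z)² = (P'Q − PQ')(℘ z)·℘'(z)` for `z ∉ Λ`, `αz ∉ Λ`, i.e.
`℘'(αz) = α⁻¹ R'(℘ z) ℘'(z)` with `R = P/Q` (Cox, *Primes of the form x² + ny²*, Prop. 14.9: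
"differentiating `℘(αz) = R(℘(z))` gives `℘'(αz) = (1/α)R'(℘(z))℘'(z)`").
[cite: Cox2013, Prop. 14.9 (PDF pp. 318–319)] -/
theorem derivWeierstrassP_mul_of_transformation (hα : α ≠ 0) (hQ0 : Q ≠ 0)
    (hdeg : Q.natDegree < P.natDegree)
    (h1 : (C 4 * X ^ 3 - C L.g₂ * X - C L.g₃) * (derivative P * Q - P * derivative Q) ^ 2 =
      C (α ^ 2) * ((C 4 * P ^ 3 - C L.g₂ * P * Q ^ 2 - C L.g₃ * Q ^ 3) * Q))
    (h2 : C 2 * ((((derivative (derivative P)) * Q - P * derivative (derivative Q)) * Q -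
        C 2 * (derivative Q * (derivative P * Q - P * derivative Q))) *
        (C 4 * X ^ 3 - C L.g₂ * X - C L.g₃)) +
      (derivative P * Q - P * derivative Q) * Q * (C 12 * X ^ 2 - C L.g₂) =
      C (α ^ 2) * (C 12 * P ^ 2 * Q - C L.g₂ * Q ^ 3))
    {z : ℂ} (hz : z ∉ L.lattice) (hαz : α * z ∉ L.lattice) :
    α * ℘'[L] (α * z) * Q.eval (℘[L] z) ^ 2 =
      (derivative P * Q - P * derivative Q).eval (℘[L] z) * ℘'[L] z := by
  have hopen : IsOpen ((L.lattice : Set ℂ)ᶜ) := L.isClosed_lattice.isOpen_compl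
  -- the identity holds near `z`
  set F : ℂ → ℂ := fun ζ ↦ P.eval (℘[L] ζ) - ℘[L] (α * ζ) * Q.eval (℘[L] ζ) with hF
  have hFev : F =ᶠ[𝓝 z] fun _ ↦ 0 := by
    have e1 : ∀ᶠ ζ : ℂ in 𝓝 z, ζ ∉ L.lattice := hopen.mem_nhds hz
    have e2 : ∀ᶠ ζ : ℂ in 𝓝 z, α * ζ ∉ L.lattice := by
      have hc1 : Continuous fun ζ : ℂ ↦ α * ζ := by fun_prop
      exact hc1.continuousAt.preimage_mem_nhds (hopen.mem_nhds hαz)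
    filter_upwards [e1, e2] with ζ h1' h2'
    simp only [hF, eval_weierstrassP_eq_weierstrassP_mul_mul hα hQ0 hdeg h1 h2 h1' h2', sub_self]
  -- derivatives of the three constituents
  have hdP : HasDerivAt (fun ζ ↦ P.eval (℘[L] ζ)) ((derivative P).eval (℘[L] z) * ℘'[L] z) z :=
    (P.hasDerivAt (℘[L] z)).comp z (hasDerivAt_weierstrassP hz)
  have hdQ : HasDerivAt (fun ζ ↦ Q.eval (℘[L] ζ)) ((derivative Q).eval (℘[L] z) * ℘'[L] z) z :=
    (Q.hasDerivAt (℘[L] z)).comp z (hasDerivAt_weierstrassP hz)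
  have hd℘ : HasDerivAt (fun ζ : ℂ ↦ ℘[L] (α * ζ)) (℘'[L] (α * z) * α) z := by
    have e1 : HasDerivAt (fun ζ : ℂ ↦ α * ζ) α z := by
      simpa using (hasDerivAt_id z).const_mul α
    exact HasDerivAt.comp (h₂ := ℘[L]) (h := fun ζ : ℂ ↦ α * ζ) z (hasDerivAt_weierstrassP hαz) e1
  have hdF : HasDerivAt F ((derivative P).eval (℘[L] z) * ℘'[L] z -
      (℘'[L] (α * z) * α * Q.eval (℘[L] z) +
        ℘[L] (α * z) * ((derivative Q).eval (℘[L] z) * ℘'[L] z))) z :=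
    hdP.sub (hd℘.mul hdQ)
  have hdF0 : HasDerivAt F 0 z := (hasDerivAt_const z (0 : ℂ)).congr_of_eventuallyEq hFev
  have hderiv := hdF.unique hdF0
  have hid := eval_weierstrassP_eq_weierstrassP_mul_mul hα hQ0 hdeg h1 h2 hz hαz
  simp only [eval_sub, eval_mul]
  linear_combination -(Q.eval (℘[L] z)) * hderiv + (derivative Q).eval (℘[L] z) * ℘'[L] z * hid

end Transformation

end PeriodPair

end
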